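import Mathlib
import HarnessLib

/-!
# Crux `FrobeniusLadder.FRationalResolution` (stmt-ResolutionOfSingularities-15317), line `redirect`,
# stub `stub_diagonalizableQuotientResolution` — ELEMENTWISE POWER RELATIONS GIVE A REDUCTION: the hypothesis
# `J^{N+1} ⊆ (y) J^N` of `…ChartFactsOfReduction` / `…TwoStepChartFactsInterface` from `n` explicit factorizations

For a finitely generated ideal `J = (x₁, …, x_n)` and any ideal `K ⊆ R` (in the application `K = (y₁,…,y_m)`, the monomials at
the vertices of the Newton polyhedron of a monomial `J`): if every generator satisfies `xᵢ^k ∈ K · J^{k-1}` (`k ≥ 1`; for monomial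
ideals ONE factorization `xᵢ^k = yⱼ · μ` with `μ ∈ J^{k-1}` each), then `J^{n(k-1)+1} ⊆ K · J^{n(k-1)}` — pigeonhole: a product
of `n(k-1)+1` generators contains some `xᵢ` at least `k` times. This is the (standard) passage from elementwise integral
dependence of bounded degree to a reduction with an explicit reduction number; it makes the reduction hypothesis of the
two-step interface checkable by finitely many explicit memberships.

* `span_pow_eq_span_pow` — `(X)^M = (X^M)` (set powers);
* `prod_mem_mul_pow_of_fiber` — the pigeonhole step for one product of generators;
* ★★ `pow_le_mul_pow_of_forall_pow_mem` — the statement above.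

Honest label: elementary commutative algebra toward ONE leaf stub (no stub, crux or summit closed). No definitions, no named
facts, no sorry. [folklore; cite: HunekeSwanson2006, Def. 1.2.1 and Cor. 1.2.5 (reductions vs. integral dependence)]
[cite: GortzWedhorn2020, (13.19) p. 415]
-/

noncomputable section

-- single-problem summit: the doubled namespace component is forced
set_option linter.dupNamespace false

open scoped Pointwise

namespace Summit.ResolutionOfSingularities.ResolutionOfSingularities.Theorems.FRationalResolution.ReductionOfPowers

variable {R : Type*} [CommRing R]

/-- `(X)^M = (X^M)`: the power of the ideal spanned by a set is spanned by the `M`-fold products. [folklore] -/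
theorem span_pow_eq_span_pow (X : Set R) (M : ℕ) : Ideal.span X ^ M = Ideal.span (X ^ M) := by
  induction M with
  | zero => rw [pow_zero, pow_zero, Ideal.one_eq_top, ← Set.singleton_one, Ideal.span_singleton_one]
  | succ M ih => rw [pow_succ, pow_succ, ih, Ideal.span_mul_span']

/-- **The pigeonhole step.** For `g : Fin M → Fin n` with `n (k-1) < M` and elements `x : Fin n → R` with
`xᵢ^k ∈ K · J^{k-1}` for all `i`, where `xᵢ ∈ J`: the product `∏_i x_{g i}` lies in `K · J^{M-1}`. [folklore] -/
theorem prod_mem_mul_pow_of_fiber {n k M : ℕ} (hk : 1 ≤ k) (hM : n * (k - 1) < M) (x : Fin n → R) (J K : Ideal R)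
    (hxJ : ∀ i, x i ∈ J) (hpow : ∀ i, x i ^ k ∈ K * J ^ (k - 1)) (g : Fin M → Fin n) :
    ∏ i, x (g i) ∈ K * J ^ (M - 1) := by
  -- a generator occurring at least `k` times
  obtain ⟨y, hy⟩ := Fintype.exists_lt_card_fiber_of_mul_lt_card g (by simpa using hM)
  set s : Finset (Fin M) := Finset.univ.filter (fun i => g i = y) with hs
  have hcard : k ≤ s.card := by
    have h := hy
    omega
  have hsM : s.card ≤ M := by
    calc s.card ≤ (Finset.univ : Finset (Fin M)).card := Finset.card_le_card (Finset.subset_univ _)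
      _ = M := by simp
  -- split the product along the fibre
  have hsplit : ∏ i, x (g i) = (∏ i ∈ s, x (g i)) * ∏ i ∈ sᶜ, x (g i) :=
    (Finset.prod_mul_prod_compl s fun i => x (g i)).symm
  have hfib : ∏ i ∈ s, x (g i) = x y ^ s.card := by
    rw [← Finset.prod_const]
    refine Finset.prod_congr rfl fun i hi => ?_
    rw [hs, Finset.mem_filter] at hi
    rw [hi.2]
  have hfib' : x y ^ s.card = x y ^ k * x y ^ (s.card - k) := by
    rw [← pow_add, Nat.add_sub_cancel' hcard]
  -- memberships
  have h1 : x y ^ k * x y ^ (s.card - k) ∈ K * J ^ (k - 1) * J ^ (s.card - k) :=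
    Ideal.mul_mem_mul (hpow y) (Ideal.pow_mem_pow (hxJ y) _)
  have h2 : ∏ i ∈ sᶜ, x (g i) ∈ J ^ (sᶜ).card := by
    rw [← Finset.prod_const]
    exact Ideal.prod_mem_prod fun i _ => hxJ (g i)
  have h3 : (∏ i ∈ s, x (g i)) * ∏ i ∈ sᶜ, x (g i) ∈ K * J ^ (k - 1) * J ^ (s.card - k) * J ^ (sᶜ).card := by
    rw [hfib, hfib']
    exact Ideal.mul_mem_mul h1 h2
  have hexp : K * J ^ (k - 1) * J ^ (s.card - k) * J ^ (sᶜ).card = K * J ^ (M - 1) := by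
    rw [Finset.card_compl, Fintype.card_fin, mul_assoc, mul_assoc, ← pow_add, ← pow_add]
    congr 2
    omega
  rw [hsplit, ← hexp]
  exact h3

/-- ★★ **ELEMENTWISE POWER RELATIONS GIVE A REDUCTION WITH AN EXPLICIT REDUCTION NUMBER.** `J = (x₁,…,x_n)`, `K` any ideal,
`k ≥ 1`, and `xᵢ^k ∈ K · J^{k-1}` for every `i` ⇒ `J^{n(k-1)+1} ⊆ K · J^{n(k-1)}`. With `K = (y₁,…,y_m) ⊆ J` this is the reduction
hypothesis `J^{N+1} ⊆ (y) J^N`, `N = n(k-1)`, of `…ChartFactsOfReduction` / `…TwoStepChartFactsInterface`.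
[folklore; cite: HunekeSwanson2006, Def. 1.2.1 and Cor. 1.2.5] -/
theorem pow_le_mul_pow_of_forall_pow_mem {n k : ℕ} (hk : 1 ≤ k) (x : Fin n → R) (K : Ideal R)
    (hpow : ∀ i, x i ^ k ∈ K * Ideal.span (Set.range x) ^ (k - 1)) :
    Ideal.span (Set.range x) ^ (n * (k - 1) + 1) ≤ K * Ideal.span (Set.range x) ^ (n * (k - 1)) := by
  set J := Ideal.span (Set.range x) with hJ
  have hxJ : ∀ i, x i ∈ J := fun i => Ideal.subset_span ⟨i, rfl⟩
  rw [hJ, span_pow_eq_span_pow, ← hJ, Ideal.span_le]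
  intro a ha
  obtain ⟨f, rfl⟩ := Set.mem_pow.mp ha
  -- each factor is some generator `x (g i)`
  have hg : ∀ i : Fin (n * (k - 1) + 1), ∃ j : Fin n, x j = (f i : R) := fun i => (f i).2
  choose g hg using hg
  have hprod : (List.ofFn fun i => (f i : R)).prod = ∏ i, x (g i) := by
    rw [List.prod_ofFn]
    exact Finset.prod_congr rfl fun i _ => (hg i).symm
  rw [SetLike.mem_coe, hprod]
  have h := prod_mem_mul_pow_of_fiber hk (Nat.lt_succ_self _) x J K hxJ hpow g
  simpa using h

/-- The same with the generating family given as a hypothesis `J = (x₁,…,x_n)`. [folklore] -/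
theorem pow_le_mul_pow_of_forall_pow_mem' {n k : ℕ} (hk : 1 ≤ k) (x : Fin n → R) (J K : Ideal R)
    (hJ : J = Ideal.span (Set.range x)) (hpow : ∀ i, x i ^ k ∈ K * J ^ (k - 1)) :
    J ^ (n * (k - 1) + 1) ≤ K * J ^ (n * (k - 1)) := by
  subst hJ
  exact pow_le_mul_pow_of_forall_pow_mem hk x K hpow

end Summit.ResolutionOfSingularities.ResolutionOfSingularities.Theorems.FRationalResolution.ReductionOfPowers

end
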